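import Literature.NumberTheory.Transcendental.BrownMotivicPeriodPoint
import Literature.NumberTheory.Transcendental.BrownIharaCoaction
import HarnessLib

/-!
# The motivic input of Brown's package in Deligne–Goncharov form

Assembly of `BrownIharaCoaction.lean` (the coaction: the orbit map `g ↦ g·₀1₁` is a homomorphism
`G_𝒰' → (₀Π₁, ∘)` for Ihara's law, [DeligneGoncharov2005, (5.10.3), Prop. 5.11, (5.12.1),
(5.15.1)]) and `BrownMotivicPeriodPoint.lean` (the period: Brown's `dch` lies on the orbit,
`dch = g τ(√t₀).γ`, [Brown2012, §2.3 (2.12)]; [DeligneGoncharov2005, 5.16, 5.18–5.20]): the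
constructor `MotivicGaloisData.ofIharaComparison` and `motivicMZV_nonempty_of_iharaComparison`.

With it, what the tree does NOT prove of [Brown2012, §2] is exactly the following statement about
the Drinfeld associator `dch` (`Brown2012.dch`, a character of the shuffle algebra with the
multiple zeta values as convergent coefficients, all proved): there exist

* a graded shuffle character `ρ : 𝒪(₀Π₁) → 𝒰' = ℚ⟨f₃, f₅, …⟩` (`ρ_nil`, `ρ_mul`, `ρ_mem`) whose
  orbit map is an Ihara homomorphism (`ρ_hom`) — the action of the motivic Galois group
  `G_𝒰 ⋊ 𝔾_m` of `MT(ℤ)`, `𝒪(G_𝒰) ≅ 𝒰'` ([Brown2012, (2.20); DeligneGoncharov2005, Prop. 2.3],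
  Borel), on the de Rham fundamental torsor through `V_ω ≅ (Π, ∘)`
  ([DeligneGoncharov2005, 5.8–5.12, (5.15.1)]);
* an even rational point `γ` of `₀Π₁` (`γ_nil`, `γ_mul`, `γ_odd`) and a real point `(g, t₀)` of
  `G_𝒰' × 𝔸¹` (`g_nil`, `g_mul`) with `g τ(√t₀).γ = dch` (`comparison`) — Betti-rationality of
  `dch` and the real Frobenius ([Brown2012, §2.3 (2.12)]; [DeligneGoncharov2005, 5.16–5.20]).

The second part makes the reading of `ρ_hom` as a homomorphy precise (**points of `G_𝒰`**):
for a commutative ring `B` and two `B`-points `g, h : 𝒰 → B` of `G_𝒰 = Spec 𝒰`, their product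
in the group scheme is the convolution `g * h = m_B ∘ (g ⊗ h) ∘ dec` (`pointMul`, through the
pairing `pairPt g h : 𝒰 ⊗ 𝒰 → B`), the pair `(x ↦ x ⊗ 1, y ↦ 1 ⊗ y)` of `BrownIharaCoaction.lean`
is the universal one (`pointMul_leftEmb_algebraMap : leftEmb * algebraMap = dec`), and `ρ_hom`
implies for EVERY pair of points `(g h)·₀1₁ = ⟨g·₀1₁⟩(h·₀1₁) · (g·₀1₁)` (`pointMul_ρ_eq_iharaMul`):
the orbit map `G_𝒰 → (₀Π₁, ∘)`, `g ↦ g·₀1₁ = g ∘ ρ`, is a natural homomorphism for Ihara's law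
([DeligneGoncharov2005, (5.10.3), Prop. 5.11, (5.12.1), (5.15.1)]).

No named fact is introduced.

## References

* F. Brown, *Mixed Tate motives over ℤ*, Ann. of Math. 175 (2012), §2; arXiv:1102.1312.
  [Brown2012]
* P. Deligne, A. B. Goncharov, *Groupes fondamentaux motiviques de Tate mixte*, Ann. Sci. ÉNS 38
  (2005), §5; arXiv:math/0302267. [DeligneGoncharov2005]
-/

noncomputable section

namespace Literature.NumberTheory.Transcendental

namespace Brown2012

open MZV ShuffleMonoidAlgebra
open GoncharovFormalIteratedIntegrals (iharaMul iharaWord conjWord conjWord_nil conjWord_cons contr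
  contr_apply)
open GoncharovFormalIteratedIntegrals renaming phi → phiK, phi_apply → phiK_apply
open GoncharovFormalIteratedIntegrals.WordSeries (X X_apply)

namespace MotivicGaloisData

/-- **The bundle from an Ihara homomorphism and the comparison `dch = g τ(√t₀).γ`**: the
Deligne–Goncharov form of the input of Brown's §2 (see the module docstring).
[cite: Brown2012, §2.1 (2.3)–(2.6), §2.3 (2.12), Theorem 2.4; DeligneGoncharov2005, (5.10.3),
Prop. 5.11, (5.12.1), (5.15.1), 5.16, 5.20] -/
def ofIharaComparison (ρ : List Bool → UAlg) (ρ_nil : ρ [] = 1)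
    (ρ_mul : ∀ u v : List Bool, ρ u * ρ v = ((shuffleWord u v).map ρ).sum)
    (ρ_mem : ∀ w : List Bool, ρ w ∈ uPrime w.length)
    (ρ_hom : ∀ w : List Bool, decHom (ρ w) = iharaMul (orbitFamilyL ρ) (orbitR ρ) w)
    (γ : List Bool → ℚ) (γ_nil : γ [] = 1)
    (γ_mul : ∀ u v : List Bool, γ u * γ v = ((shuffleWord u v).map γ).sum)
    (γ_odd : ∀ w : List Bool, Odd w.length → γ w = 0)
    (g : List ℕ → ℝ) (g_nil : g [] = 1)
    (g_mul : ∀ a b : List ℕ, g a * g b = ((shuffleWord a b).map g).sum) (t₀ : ℝ)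
    (comparison : ∀ w : List Bool, perLin g t₀ (Ψ ρ γ w) = dch w) : MotivicGaloisData :=
  ofIharaHom ρ ρ_nil ρ_mul ρ_mem ρ_hom γ γ_nil γ_mul γ_odd g g_nil g_mul t₀
    fun _ hs => (comparison _).trans (dch_rho hs)

/-- The constructor does not change `ρ`. [folklore] -/
@[simp] theorem ofIharaComparison_ρ (ρ : List Bool → UAlg) (ρ_nil ρ_mul ρ_mem ρ_hom)
    (γ : List Bool → ℚ) (γ_nil γ_mul γ_odd) (g : List ℕ → ℝ) (g_nil g_mul) (t₀ : ℝ)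
    (comparison) :
    (ofIharaComparison ρ ρ_nil ρ_mul ρ_mem ρ_hom γ γ_nil γ_mul γ_odd g g_nil g_mul t₀
      comparison).ρ = ρ :=
  rfl

end MotivicGaloisData

/-- **Brown's package from the Deligne–Goncharov input**: an Ihara-homomorphic graded shuffle
character `ρ : 𝒪(₀Π₁) → 𝒰'`, an even rational point `γ` and a real point `(g, t₀)` with
`g τ(√t₀).γ = dch` yield an inhabitant of `MotivicMZV` (everything else in [Brown2012, §§2–3.1]
being theorems of the tree). [cite: Brown2012, §§2.1–2.5, §3.1; DeligneGoncharov2005, 5.8–5.20] -/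
theorem motivicMZV_nonempty_of_iharaComparison (ρ : List Bool → UAlg) (ρ_nil : ρ [] = 1)
    (ρ_mul : ∀ u v : List Bool, ρ u * ρ v = ((shuffleWord u v).map ρ).sum)
    (ρ_mem : ∀ w : List Bool, ρ w ∈ uPrime w.length)
    (ρ_hom : ∀ w : List Bool, decHom (ρ w) = iharaMul (orbitFamilyL ρ) (orbitR ρ) w)
    (γ : List Bool → ℚ) (γ_nil : γ [] = 1)
    (γ_mul : ∀ u v : List Bool, γ u * γ v = ((shuffleWord u v).map γ).sum)
    (γ_odd : ∀ w : List Bool, Odd w.length → γ w = 0)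
    (g : List ℕ → ℝ) (g_nil : g [] = 1)
    (g_mul : ∀ a b : List ℕ, g a * g b = ((shuffleWord a b).map g).sum) (t₀ : ℝ)
    (comparison : ∀ w : List Bool, perLin g t₀ (Ψ ρ γ w) = dch w) :
    motivicMZV_nonempty :=
  ⟨(MotivicGaloisData.ofIharaComparison ρ ρ_nil ρ_mul ρ_mem ρ_hom γ γ_nil γ_mul γ_odd g g_nil
    g_mul t₀ comparison).toMotivicMZV⟩

/-! ## Points of `G_𝒰` and the orbit map as a natural homomorphism -/

section Points

variable {B : Type} [CommRing B]

/-- **Change of coefficients of word series along a ring homomorphism** (coefficientwise), a ring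
homomorphism for the concatenation product. [folklore] -/
def mapSeries (φ : UU →+* B) :
    GoncharovFormalIteratedIntegrals.WordSeries Bool UU →+*
      GoncharovFormalIteratedIntegrals.WordSeries Bool B where
  toFun f := fun w => φ (f w)
  map_one' := GoncharovFormalIteratedIntegrals.WordSeries.ext fun w => by
    rcases w with _ | ⟨s, w⟩
    · show φ ((1 : GoncharovFormalIteratedIntegrals.WordSeries Bool UU) []) = _
      rw [GoncharovFormalIteratedIntegrals.WordSeries.one_nil, map_one]; rfl
    · show φ ((1 : GoncharovFormalIteratedIntegrals.WordSeries Bool UU) (s :: w)) = _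
      rw [GoncharovFormalIteratedIntegrals.WordSeries.one_cons, map_zero]; rfl
  map_mul' f g := GoncharovFormalIteratedIntegrals.WordSeries.ext fun w => by
    show φ ((f * g) w) = _
    rw [GoncharovFormalIteratedIntegrals.WordSeries.mul_apply,
      GoncharovFormalIteratedIntegrals.WordSeries.mul_apply, map_sum]
    simp only [map_mul]
  map_zero' := GoncharovFormalIteratedIntegrals.WordSeries.ext fun w => by
    show φ ((0 : GoncharovFormalIteratedIntegrals.WordSeries Bool UU) w) = _
    rw [GoncharovFormalIteratedIntegrals.WordSeries.zero_apply, map_zero]; rfl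
  map_add' f g := GoncharovFormalIteratedIntegrals.WordSeries.ext fun w => by
    show φ ((f + g) w) = _
    rw [GoncharovFormalIteratedIntegrals.WordSeries.add_apply, map_add]; rfl

variable (φ : UU →+* B)

/-- Coefficients of `mapSeries`. [folklore] -/
@[simp] theorem mapSeries_apply (f : GoncharovFormalIteratedIntegrals.WordSeries Bool UU)
    (w : List Bool) : mapSeries φ f w = φ (f w) := rfl

/-- Letters are preserved. [folklore] -/
theorem mapSeries_X (k : Bool) : mapSeries φ (X k) = X k :=
  GoncharovFormalIteratedIntegrals.WordSeries.ext fun w => by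
    rw [mapSeries_apply, X_apply, X_apply]
    split_ifs
    · exact map_one φ
    · exact map_zero φ

/-- Generating series of families are mapped coefficientwise. [folklore] -/
theorem mapSeries_phiK (K : Bool → List Bool → Bool → UU) (x y : Bool) :
    mapSeries φ (phiK K x y) = phiK (fun x u y => φ (K x u y)) x y :=
  GoncharovFormalIteratedIntegrals.WordSeries.ext fun _ => rfl

/-- Conjugated words are mapped coefficientwise. [folklore] -/
theorem mapSeries_conjWord (K : Bool → List Bool → Bool → UU) (p : Bool) :
    ∀ c : List Bool, mapSeries φ (conjWord K p c) = conjWord (fun x u y => φ (K x u y)) p c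
  | [] => by rw [conjWord_nil, conjWord_nil, map_one]
  | k :: c => by
    rw [conjWord_cons, conjWord_cons, map_mul, map_mul, map_mul, mapSeries_conjWord K p c,
      mapSeries_phiK, mapSeries_phiK, mapSeries_X]

/-- Contractions are mapped coefficientwise. [folklore] -/
theorem mapSeries_contr (f : GoncharovFormalIteratedIntegrals.WordSeries Bool UU)
    (Θ : List Bool → GoncharovFormalIteratedIntegrals.WordSeries Bool UU) :
    mapSeries φ (contr f Θ) = contr (mapSeries φ f) fun c => mapSeries φ (Θ c) :=
  GoncharovFormalIteratedIntegrals.WordSeries.ext fun w => by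
    rw [mapSeries_apply, contr_apply, contr_apply, map_sum]
    simp only [map_mul, mapSeries_apply]

/-- **Ihara's map is compatible with change of coefficients**: `φ(⟨a⟩(x)·a) = ⟨φa⟩(φx)·φa`.
[cite: DeligneGoncharov2005, (5.11.5)] -/
theorem mapSeries_iharaMul (K : Bool → List Bool → Bool → UU)
    (x : GoncharovFormalIteratedIntegrals.WordSeries Bool UU) :
    mapSeries φ (iharaMul K x) = iharaMul (fun x u y => φ (K x u y)) (mapSeries φ x) := by
  rw [iharaMul, iharaMul, map_mul, mapSeries_contr, mapSeries_phiK, iharaWord, iharaWord]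
  simp only [mapSeries_conjWord]

variable (g h : UAlg →+* B)

/-- **The pairing of two points**: `pairPt g h : 𝒰 ⊗ 𝒰 → B`, `x ⊗ y ↦ g(x) h(y)` (the word part
of `UU` read through `g`, the coefficient through `h`). [cite: Brown2012, (2.20)] -/
def pairPt : UU →+* B :=
  letI : Algebra UAlg B := h.toAlgebra
  (lift (fun p : ℕ × List ℕ => g (e p.1 p.2)) (by rw [e_zero_nil, map_one]) fun p q => by
      rw [← map_mul, e_mul_e, map_list_sum, List.map_map]; rfl).toRingHom

/-- `pairPt g h (w ⊗ c) = h(c) g(w)`. [folklore] -/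
theorem pairPt_single (p : ℕ × List ℕ) (c : UAlg) :
    pairPt g h (single p c) = h c * g (e p.1 p.2) := by
  letI : Algebra UAlg B := h.toAlgebra
  show lift (fun p : ℕ × List ℕ => g (e p.1 p.2)) _ _ (single p c) = _
  rw [lift_single, Algebra.smul_def]
  rfl

/-- `pairPt g h (x ⊗ 1) = g(x)` (any two ring homomorphisms agree on the image of `ℚ`).
[folklore] -/
theorem pairPt_leftEmb (x : UAlg) : pairPt g h (leftEmb x) = g x := by
  classical
  have hq : ∀ r : ℚ, h (algebraMap ℚ UAlg r) = g (algebraMap ℚ UAlg r) := fun r =>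
    RingHom.congr_fun (RingHom.ext_rat (h.comp (algebraMap ℚ UAlg)) (g.comp (algebraMap ℚ UAlg))) r
  induction x using ShuffleMonoidAlgebra.induction_linear with
  | h0 => rw [map_zero, map_zero, map_zero]
  | hadd x y hx hy => rw [map_add, map_add, hx, hy, map_add]
  | hsingle p r =>
    rw [leftEmb_single, pairPt_single, hq, ← map_mul, ← Algebra.smul_def, smul_e]

/-- `pairPt g h (1 ⊗ y) = h(y)`. [folklore] -/
theorem pairPt_algebraMap (y : UAlg) : pairPt g h (algebraMap UAlg UU y) = h y := by
  rw [ShuffleMonoidAlgebra.algebraMap_apply, pairPt_single, e_zero_nil, map_one, mul_one]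

/-- **The product of two points of `G_𝒰 = Spec 𝒰`**: the convolution `g * h = m_B ∘ (g ⊗ h) ∘ Δ`
dual to the deconcatenation coproduct `Δ = decHom` ((2.20): "`Δ` is the coproduct … which makes
`𝒰'` into a Hopf algebra"). [cite: Brown2012, (2.20)–(2.21)] -/
def pointMul : UAlg →+* B := (pairPt g h).comp decHom

/-- The convolution on a symbol: `(g*h)(f₂^m f_w) = Σ_{w = w₁w₂} h(f₂^m f_{w₂}) g(f_{w₁})`.
[cite: Brown2012, (2.20)] -/
theorem pointMul_single (p : ℕ × List ℕ) (r : ℚ) :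
    pointMul g h (single p r) = ∑ k ∈ Finset.range (p.2.length + 1),
      h (single (p.1, p.2.drop k) r) * g (e 0 (p.2.take k)) := by
  rw [pointMul, RingHom.comp_apply, decHom_single, map_sum]
  exact Finset.sum_congr rfl fun k _ => pairPt_single g h _ _

/-- The pairing of the universal pair `(x ↦ x ⊗ 1, y ↦ 1 ⊗ y)` is the identity of `𝒰 ⊗ 𝒰`.
[folklore] -/
theorem pairPt_leftEmb_algebraMap_apply (x : UU) : pairPt leftEmb (algebraMap UAlg UU) x = x := by
  classical
  induction x using ShuffleMonoidAlgebra.induction_linear with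
  | h0 => rw [map_zero]
  | hadd x y hx hy => rw [map_add, hx, hy]
  | hsingle p c =>
    obtain ⟨m, w⟩ := p
    rw [pairPt_single, e_def, leftEmb_single, map_one, ← Algebra.smul_def, smul_single, mul_one]

/-- **The universal pair of points**: for `(g, h) = (x ↦ x ⊗ 1, y ↦ 1 ⊗ y)` the product `g * h` is
the generic point `Δ = decHom` itself — so the hypothesis `ρ_hom` of `MotivicGaloisData.ofIharaHom`
is the instance `(leftEmb, algebraMap)` of `pointMul_ρ_eq_iharaMul`. [cite: Brown2012, (2.20)] -/
theorem pointMul_leftEmb_algebraMap : pointMul leftEmb (algebraMap UAlg UU) = decHom :=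
  RingHom.ext fun x => by
    rw [pointMul, RingHom.comp_apply, pairPt_leftEmb_algebraMap_apply]

/-- **The orbit map is a natural homomorphism for Ihara's law.** If `ρ` satisfies `ρ_hom`
(homomorphy at the universal pair of points), then for every commutative ring `B` and all points
`g, h ∈ G_𝒰(B)`, with `a_g = g·₀1₁ = g ∘ ρ ∈ ₀Π₁(B)` (its family `Iᵐ_{a_g} = g ∘ Iᵐ_ρ`):
`(g*h)·₀1₁ = ⟨a_g⟩(a_h) · a_g` — [DG05, (5.12.1)] `a ∘ b = a·⟨a⟩₀(b)` in Brown's orientation, i.e.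
`g ↦ g·₀1₁` is a homomorphism `G_𝒰(B) → (₀Π₁(B), ∘)`, naturally in `B`
([DG05, (5.10.3)/(5.15.1)]: `U_ω → V_ω ≅ Π` is a morphism of group schemes).
[cite: DeligneGoncharov2005, (5.10.3), Prop. 5.11, (5.12.1), (5.15.1); Brown2012, §2.1
(2.3)–(2.6)] -/
theorem pointMul_ρ_eq_iharaMul (ρ : List Bool → UAlg)
    (ρ_hom : ∀ w : List Bool, decHom (ρ w) = iharaMul (orbitFamilyL ρ) (orbitR ρ) w)
    (w : List Bool) :
    pointMul g h (ρ w) = iharaMul (fun x u y => g (Im ρ x u y)) (fun c => h (ρ c)) w := by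
  rw [pointMul, RingHom.comp_apply, ρ_hom w, ← mapSeries_apply (pairPt g h), mapSeries_iharaMul]
  congr 1
  · funext x u y
    exact pairPt_leftEmb g h _
  · exact GoncharovFormalIteratedIntegrals.WordSeries.ext fun c => pairPt_algebraMap g h _

end Points

end Brown2012

end Literature.NumberTheory.Transcendental
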